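import Literature.MathematicalPhysics.KineticTheory.HierarchyPruningEstimates
import HarnessLib

/-!
# Energy truncation of the pruned expansion (BGSR Proposition 5.4, abstract form)
(Bodineau–Gallagher–Saint-Raymond, Invent. Math. 203 (2016) = arXiv:1305.3397v2, §5.3.1 "Energy
truncation", Proposition 5.4; trunk T-KINETIC, topic MathematicalPhysics/KineticTheory; a layer
(N5d₁) of the bottom-up proof plan of the named fact `bgsr_theorem22` / fact (c)
`bodineau_gallagher_saintRaymond_linear` recorded in `TaggedSphereLinearBoltzmann`, on top of the
pruning estimates `HierarchyPruningEstimates` (N4b).)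

BGSR §5.3.1 cut off the large velocities in the main term `f^{(1,K)}_N` of the pruned expansion
((4.10); `HierarchyModel.blockComp K [F(0)]` of N4a) by inserting the indicator
`1_{H_{J_K}(Z_{J_K}(0)) ≤ E²/2}` of the kinetic energy of the pseudo-trajectory at time `0`, i.e.
by replacing the datum `f_N^{0(k)}` with `1_{H_k ≤ E²/2} f_N^{0(k)}` at every level (the energy
of a pseudo-trajectory at time `0` is the energy of the configuration at which the datum is
evaluated), and Proposition 5.4 states: *"There is a constant `C` depending only on `β` and `d`
such that, as `N` goes to infinity in the scaling `N ε^{d-1} α⁻¹ ≡ 1`, the following bounds hold: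
`‖f_N^{(1,K)} - f_{N,E}^{(1,K)}‖_{L^∞([0,t] × T^d × ℝ^d)} + ‖g_α^{(1,K)} - g_{α,E}^{(1,K)}‖_{L^∞} ≤
A^{K(K+1)} (C α t)^{A^{K+1}} e^{-β E²/4} ‖ρ⁰‖_{L^∞}`, with `A, K` as in Proposition 4.3."* The
printed proof: `‖1_{H ≥ E²/2} f_N^{0(J_K)}‖_{ε,J_K,β/2} ≤ ‖f_N^{0(J_K)}‖_{ε,J_K,β} e^{-βE²/4}
≤ C^{J_K} e^{-βE²/4} ‖ρ⁰‖` (the tail costs half of the Gaussian weight), then the continuity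
estimate of Lemma 4.2 on the block part and the count of the terms.

This file PROVES the proposition for an abstract `HierarchyModel` and any nice initial family
`G` with `|G^{(k)}| ≤ R C₀^k e^{-β H_k}` (`IsLevelBdd`), in the form produced by the block-by-block
weighted estimate of N4b (`HierarchyModel.abs_blockComp_le`, floor `β/4`, budgets
`(β/4) 2^{-(K-b)}`): `|(blockComp K [G])^{(1)}(Z) - (blockComp K [1_{H ≤ E²/2} G])^{(1)}(Z)|
≤ R e^{-βE²/4} C₀ exp(6 C₀ c'_R h A^K)`, `c'_R = pruneConst M (β/2)` — the printed mechanism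
(`e^{-βE²/4}` from half the weight) with the block cost of N4b in place of
`A^{K(K+1)} (Cαt)^{A^{K+1}}` (both are `exp(O(A^{K+1}))` under the step condition of Prop. 4.3,
`C₀ c_R h ≤ γ/e²`, since `c'_R = 2^{(d+1)/2} c_R`).

## Main definitions and results

* `energyTruncate E G`, `energyTail E G` — `1_{H ≤ E²/2} G` and `1_{H > E²/2} G` levelwise;
  `energyTruncate_add_energyTail`.
* `isLevelBdd_energyTail` — the tail is bounded with half the weight and the factor `e^{-βE²/4}`.
* `HierarchyModel.abs_blockComp_sub_energyTruncate_le` — Proposition 5.4, abstract form.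

## References

* T. Bodineau, I. Gallagher, L. Saint-Raymond, *The Brownian motion as the limit of a
  deterministic system of hard-spheres*, Invent. Math. 203 (2016) 493–553 = arXiv:1305.3397v2,
  §5.3.1, Proposition 5.4 and its proof (p. 19 of the held text).
-/

open MeasureTheory Metric Real Set Filter Function
open scoped Nat
open Literature.Analysis.FluidPDE (Config configEnergy GCState)

namespace Literature.MathematicalPhysics.KineticTheory

noncomputable section

section Kinetic

variable {d : Type*} [Fintype d] {X : Type*}

/-! ## Energy truncation of a family -/

section Truncation

/-- The kinetic energy is a measurable function of the configuration, over any measurable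
position space (the torus case is `Literature.Analysis.FluidPDE.measurable_configEnergy`). [folklore] -/
theorem measurable_configEnergy' [MeasurableSpace X] (s : ℕ) :
    Measurable (configEnergy : Config s d X → ℝ) := by
  unfold Literature.Analysis.FluidPDE.configEnergy
  refine measurable_const.mul (Finset.measurable_sum _ fun i _ => ?_)
  exact ((measurable_pi_apply i).snd.norm).pow_const 2

/-- The energy cut-off of a family at every level: `(1_{H_k ≤ E²/2} G^{(k)})_k` (BGSR §5.3.1: the
datum of the main term restricted to `{H_{J_K}(Z_{J_K}(0)) ≤ E²/2}`).
[cite: BodineauGallagherSaintRaymondInvent2016, §5.3.1, p. 19] -/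
def energyTruncate (E : ℝ) (G : GCState d X) : GCState d X :=
  fun k Z => if configEnergy Z ≤ E ^ 2 / 2 then G k Z else 0

/-- The energy tail of a family at every level: `(1_{H_k > E²/2} G^{(k)})_k`.
[cite: BodineauGallagherSaintRaymondInvent2016, §5.3.1, p. 19] -/
def energyTail (E : ℝ) (G : GCState d X) : GCState d X :=
  fun k Z => if configEnergy Z ≤ E ^ 2 / 2 then 0 else G k Z

/-- Unfolding lemma for `energyTruncate`. [folklore] -/
theorem energyTruncate_apply (E : ℝ) (G : GCState d X) (k : ℕ) (Z : Config k d X) :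
    energyTruncate E G k Z = if configEnergy Z ≤ E ^ 2 / 2 then G k Z else 0 := rfl

/-- Unfolding lemma for `energyTail`. [folklore] -/
theorem energyTail_apply (E : ℝ) (G : GCState d X) (k : ℕ) (Z : Config k d X) :
    energyTail E G k Z = if configEnergy Z ≤ E ^ 2 / 2 then 0 else G k Z := rfl

/-- `G = 1_{H ≤ E²/2} G + 1_{H > E²/2} G`. [folklore] -/
theorem energyTruncate_add_energyTail (E : ℝ) (G : GCState d X) :
    energyTruncate E G + energyTail E G = G := by
  funext k Z
  simp only [Pi.add_apply, energyTruncate_apply, energyTail_apply]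
  split_ifs <;> simp

/-- The truncation does not increase absolute values. [folklore] -/
theorem abs_energyTruncate_le (E : ℝ) (G : GCState d X) (k : ℕ) (Z : Config k d X) :
    |energyTruncate E G k Z| ≤ |G k Z| := by
  rw [energyTruncate_apply]
  split_ifs <;> simp

/-- The tail does not increase absolute values. [folklore] -/
theorem abs_energyTail_le (E : ℝ) (G : GCState d X) (k : ℕ) (Z : Config k d X) :
    |energyTail E G k Z| ≤ |G k Z| := by
  rw [energyTail_apply]
  split_ifs <;> simp

variable [MeasurableSpace X]

/-- The truncation of a nice density is nice. [folklore] -/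
theorem IsNice.energyTruncate {k : ℕ} {G : GCState d X} (hG : IsNice (G k)) (E : ℝ) :
    IsNice (energyTruncate E G k) := by
  refine ⟨?_, hG.2.of_abs_le fun Z => abs_energyTruncate_le E G k Z⟩
  exact Measurable.ite (measurableSet_le (measurable_configEnergy' k) measurable_const) hG.1
    measurable_const

/-- The tail of a nice density is nice. [folklore] -/
theorem IsNice.energyTail {k : ℕ} {G : GCState d X} (hG : IsNice (G k)) (E : ℝ) :
    IsNice (energyTail E G k) := by
  refine ⟨?_, hG.2.of_abs_le fun Z => abs_energyTail_le E G k Z⟩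
  exact Measurable.ite (measurableSet_le (measurable_configEnergy' k) measurable_const)
    measurable_const hG.1

omit [MeasurableSpace X] in
/-- **The tail costs half of the weight** (BGSR (5.8) in the proof of Prop. 5.4:
`‖1_{H ≥ E²/2} f^{0(J)}‖_{J,β/2} ≤ ‖f^{0(J)}‖_{J,β} e^{-βE²/4}`): if `|G^{(a)}| ≤ R C₀^a e^{-β H}` at
the levels `a ≤ L`, `β ≥ 0`, then `|1_{H > E²/2} G^{(a)}| ≤ R e^{-βE²/4} C₀^a e^{-(β/2) H}` there.
[cite: BodineauGallagherSaintRaymondInvent2016, §5.3.1, proof of Prop. 5.4, p. 19] -/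
theorem isLevelBdd_energyTail {G : GCState d X} {L : ℕ} {R C₀ β : ℝ} (hG : IsLevelBdd G L R C₀ β)
    (hβ : 0 ≤ β) (E : ℝ) :
    IsLevelBdd (energyTail E G) L (R * exp (-(β * E ^ 2 / 4))) C₀ (β / 2) := by
  intro a ha Z
  have hb := hG a ha Z
  -- `0 ≤ R C₀^a` from `0 ≤ |G| ≤ R C₀^a e^{-βH}`
  have h' : 0 ≤ R * C₀ ^ a := by
    by_contra hneg
    have : R * C₀ ^ a * exp (-β * configEnergy Z) < 0 :=
      mul_neg_of_neg_of_pos (lt_of_not_ge hneg) (exp_pos _)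
    linarith [abs_nonneg (G a Z)]
  rw [energyTail_apply]
  split_ifs with hE
  · rw [abs_zero]
    calc (0 : ℝ) ≤ R * C₀ ^ a * (exp (-(β * E ^ 2 / 4)) * exp (-(β / 2) * configEnergy Z)) :=
          mul_nonneg h' (by positivity)
      _ = _ := by ring
  · have hE' : E ^ 2 / 2 < configEnergy Z := lt_of_not_ge hE
    have hexp : exp (-β * configEnergy Z) ≤ exp (-(β * E ^ 2 / 4)) * exp (-(β / 2) * configEnergy Z) := by
      rw [← exp_add]
      exact exp_le_exp.2 (by nlinarith [mul_nonneg hβ (sub_nonneg.2 hE'.le)])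
    calc |G a Z| ≤ R * C₀ ^ a * exp (-β * configEnergy Z) := hb
      _ ≤ R * C₀ ^ a * (exp (-(β * E ^ 2 / 4)) * exp (-(β / 2) * configEnergy Z)) :=
          mul_le_mul_of_nonneg_left hexp h'
      _ = _ := by ring

end Truncation

/-! ## BGSR Proposition 5.4 -/

section Prop54

variable [MeasurableSpace X] (M : HierarchyModel d X)

namespace HierarchyModel

/-- The block factor of the energy-truncation estimate: with floor `β/4` and budgets
`(β/4) 2^{-(K-b)}`, the `K` blocks cost at most `exp(6 C₀ c'_R h A^K)`, `c'_R = pruneConst M (β/2)`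
(the computation of N4b's `abs_blockComp_iterRem_le`, part (b), at half the weight). [folklore] -/
theorem prod_blockFactor_half_le {A : ℕ} (hA : 2 ≤ A) {C₀ β h : ℝ} (hC₀ : 1 ≤ C₀) (hβ : 0 < β)
    (hh0 : 0 ≤ h) (K : ℕ) :
    ∏ b ∈ Finset.range K, ∑ j ∈ Finset.range (pruneSeq A b),
        (C₀ * M.chainCost (β / 4) (β / 4 / 2 ^ (K - b) / pruneSeq A b) (pruneLevel A (b + 1)) * h) ^ j / j ! ≤
      exp (6 * (C₀ * M.pruneConst (β / 2) * h) * (A : ℝ) ^ K) := by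
  have hA1 : 1 ≤ A := by omega
  have hC₀0 : 0 ≤ C₀ := zero_le_one.trans hC₀
  set x := C₀ * M.pruneConst (β / 2) * h with hx
  have hx0 : 0 ≤ x := by
    have := M.pruneConst_nonneg (β / 2)
    positivity
  have hblock_le : ∀ b ∈ Finset.range K, ∑ j ∈ Finset.range (pruneSeq A b),
      (C₀ * M.chainCost (β / 4) (β / 4 / 2 ^ (K - b) / pruneSeq A b) (pruneLevel A (b + 1)) * h) ^ j / j ! ≤
        exp (x * ((A : ℝ) ^ (b + 1) * sqrt 2 ^ (K - b))) := by
    intro b hb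
    have hnb : (0 : ℝ) < pruneSeq A b := by exact_mod_cast one_le_pruneSeq hA1 b
    have hq : (1 : ℝ) ≤ sqrt 2 ^ (K - b) := one_le_pow₀ Real.one_lt_sqrt_two.le
    have hΛb : M.chainCost (β / 4) (β / 4 / 2 ^ (K - b) / pruneSeq A b) (pruneLevel A (b + 1)) ≤
        M.pruneConst (β / 2) * pruneSeq A b * sqrt 2 ^ (K - b) := by
      have hfloor : β / 4 = β / 2 / 2 := by ring
      rw [hfloor]
      refine M.chainCost_le (half_pos hβ) hq hnb ?_ ?_
      · -- `(β/2)/4/(n q²) ≤ (β/4)/2^{K-b}/n`: the left-hand side is half the right-hand side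
        have hq2 : (sqrt 2 ^ (K - b)) ^ 2 = (2 : ℝ) ^ (K - b) := by
          rw [← pow_mul, mul_comm (K - b) 2, pow_mul, sq_sqrt zero_le_two]
        rw [hq2]
        have hpos : 0 ≤ β / 2 / 2 / 2 ^ (K - b) / (pruneSeq A b : ℝ) := by positivity
        have heq : β / 2 / 4 / ((pruneSeq A b : ℝ) * 2 ^ (K - b)) =
            β / 2 / 2 / 2 ^ (K - b) / (pruneSeq A b : ℝ) / 2 := by
          field_simp
          ring
        rw [heq]
        linarith
      · have := pruneLevel_succ_le hA b
        have h' : ((pruneLevel A (b + 1) : ℕ) : ℝ) ≤ ((2 * A ^ (b + 1) : ℕ) : ℝ) := by exact_mod_cast this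
        simpa [pruneSeq_apply] using h'
    have h0 : 0 ≤ C₀ * M.chainCost (β / 4) (β / 4 / 2 ^ (K - b) / pruneSeq A b) (pruneLevel A (b + 1)) * h := by
      have := M.chainCost_nonneg (β / 4) (β / 4 / 2 ^ (K - b) / pruneSeq A b) (pruneLevel A (b + 1))
      positivity
    refine (Real.sum_le_exp_of_nonneg h0 _).trans (exp_le_exp.2 ?_)
    calc C₀ * M.chainCost (β / 4) (β / 4 / 2 ^ (K - b) / pruneSeq A b) (pruneLevel A (b + 1)) * h
        ≤ C₀ * (M.pruneConst (β / 2) * pruneSeq A b * sqrt 2 ^ (K - b)) * h := by gcongr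
      _ = x * ((A : ℝ) ^ (b + 1) * sqrt 2 ^ (K - b)) := by
          rw [hx, pruneSeq_apply]; push_cast; ring
  calc ∏ b ∈ Finset.range K, ∑ j ∈ Finset.range (pruneSeq A b),
        (C₀ * M.chainCost (β / 4) (β / 4 / 2 ^ (K - b) / pruneSeq A b) (pruneLevel A (b + 1)) * h) ^ j / j !
      ≤ ∏ b ∈ Finset.range K, exp (x * ((A : ℝ) ^ (b + 1) * sqrt 2 ^ (K - b))) := by
        refine Finset.prod_le_prod (fun b _ => Finset.sum_nonneg fun j _ => ?_) hblock_le
        have := M.chainCost_nonneg (β / 4) (β / 4 / 2 ^ (K - b) / pruneSeq A b) (pruneLevel A (b + 1))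
        positivity
    _ = exp (x * ∑ b ∈ Finset.range K, (A : ℝ) ^ (b + 1) * sqrt 2 ^ (K - b)) := by
        rw [Finset.mul_sum, Real.exp_sum]
    _ ≤ exp (6 * x * (A : ℝ) ^ K) := by
        refine exp_le_exp.2 ?_
        have hs := sum_pow_mul_sqrt_two_pow_le hA K
        calc x * ∑ b ∈ Finset.range K, (A : ℝ) ^ (b + 1) * sqrt 2 ^ (K - b) ≤ x * (6 * (A : ℝ) ^ K) :=
              mul_le_mul_of_nonneg_left hs hx0
          _ = 6 * x * (A : ℝ) ^ K := by ring

/-- **BGSR Proposition 5.4 (energy truncation), abstract form.** Let `M` be a hierarchy model,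
`A ≥ 2`, `n_k = A^k`, `K` blocks of duration `h ≥ 0`, and `G` a family in the Lanford class
(`IsNice` at every level) with `|G^{(k)}(Z)| ≤ R C₀^k e^{-β H_k(Z)}` at the levels `k ≤ L_K`
(`R ≥ 0`, `C₀ ≥ 1`, `β > 0`). Then the main term of the pruned expansion built on `G` and the one
built on the energy cut-off `1_{H ≤ E²/2} G` differ, at level one, by at most
`R e^{-βE²/4} C₀ exp(6 C₀ c'_R h A^K)`, `c'_R = pruneConst M (β/2)`: additivity of the blocks
(`blockComp_add`, `G = 1_{H ≤ E²/2} G + 1_{H > E²/2} G`), the tail bound `isLevelBdd_energyTail`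
(half the weight, factor `e^{-βE²/4}`, BGSR (5.8)) and the block estimate `abs_blockComp_le` of N4b
with floor `β/4`. Printed: `A^{K(K+1)} (C α t)^{A^{K+1}} e^{-βE²/4} ‖ρ⁰‖_∞` for both hierarchies.
[cite: BodineauGallagherSaintRaymondInvent2016, §5.3.1 Prop. 5.4, p. 19] -/
theorem abs_blockComp_sub_energyTruncate_le {A : ℕ} (hA : 2 ≤ A) {R C₀ β : ℝ} (hR : 0 ≤ R)
    (hC₀ : 1 ≤ C₀) (hβ : 0 < β) {G : GCState d X} (hGn : ∀ k, IsNice (G k)) (K : ℕ)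
    (hG : IsLevelBdd G (pruneLevel A K) R C₀ β) {h : ℝ} (hh0 : 0 ≤ h) (E : ℝ) (Z : Config 1 d X) :
    |M.blockComp (pruneSeq A) h K G 1 Z - M.blockComp (pruneSeq A) h K (energyTruncate E G) 1 Z| ≤
      R * exp (-(β * E ^ 2 / 4)) * C₀ * exp (6 * (C₀ * M.pruneConst (β / 2) * h) * (A : ℝ) ^ K) := by
  have hA1 : 1 ≤ A := by omega
  have hC₀0 : 0 ≤ C₀ := zero_le_one.trans hC₀
  -- the difference is the main term built on the tail
  have hsplit : M.blockComp (pruneSeq A) h K G 1 Z =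
      M.blockComp (pruneSeq A) h K (energyTruncate E G) 1 Z +
        M.blockComp (pruneSeq A) h K (energyTail E G) 1 Z := by
    have hadd := blockComp_add (M := M) (pruneSeq A) hh0 K (G₁ := energyTruncate E G)
      (G₂ := energyTail E G) (fun a => (hGn a).energyTruncate E) (fun a => (hGn a).energyTail E)
    rw [energyTruncate_add_energyTail] at hadd
    rw [hadd, Pi.add_apply, Pi.add_apply]
  rw [hsplit, add_sub_cancel_left]
  -- block estimate with floor `β/4`, budgets `(β/4) 2^{-(K-b)}`, weight `β/2` on the tail
  set βs : ℕ → ℝ := fun b => β / 4 / 2 ^ (K - b) with hβs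
  have hβs0 : ∀ b, 0 < βs b := fun b => by positivity
  have hbudget : β / 4 + ∑ b ∈ Finset.range K, βs b ≤ β / 2 := by
    have hsum : ∑ b ∈ Finset.range K, βs b = β / 4 * ∑ b ∈ Finset.range K, (1 / 2 : ℝ) ^ (K - b) := by
      rw [Finset.mul_sum]
      refine Finset.sum_congr rfl fun b _ => ?_
      show β / 4 / 2 ^ (K - b) = β / 4 * (1 / 2) ^ (K - b)
      rw [one_div, inv_pow, div_eq_mul_inv]
    rw [hsum]
    nlinarith [sum_half_pow_le K, hβ]
  have htail := isLevelBdd_energyTail hG hβ.le E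
  have hR' : 0 ≤ R * exp (-(β * E ^ 2 / 4)) := by positivity
  have hblk := M.abs_blockComp_le hA1 (by positivity : 0 < β / 4) hC₀ βs hβs0 hh0 K _ _ _ hR' hbudget htail Z
  refine hblk.trans ?_
  have hprod := M.prod_blockFactor_half_le hA hC₀ hβ hh0 K
  have h0 : 0 ≤ R * exp (-(β * E ^ 2 / 4)) * C₀ := by positivity
  calc R * exp (-(β * E ^ 2 / 4)) * C₀ * ∏ b ∈ Finset.range K, ∑ j ∈ Finset.range (pruneSeq A b),
        (C₀ * M.chainCost (β / 4) (βs b / pruneSeq A b) (pruneLevel A (b + 1)) * h) ^ j / j !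
      ≤ R * exp (-(β * E ^ 2 / 4)) * C₀ * exp (6 * (C₀ * M.pruneConst (β / 2) * h) * (A : ℝ) ^ K) :=
        mul_le_mul_of_nonneg_left hprod h0

end HierarchyModel

end Prop54

end Kinetic

end

end Literature.MathematicalPhysics.KineticTheory
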